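import Summits.MatrixMultiplication.MatrixMultiplication.Theses.AutomaticSTPPDesigns

/-!
# Route `AutomaticSTPPDesigns` — the assembly item

Item `stmt-MatrixMultiplication-7363` (`Assembly`) of route
`route-MatrixMultiplication-AutomaticSTPPDesigns` is the implication
`AutomaticPackingThesis → MatrixMultiplication`: a base `p ≥ 2` such that for every `ε > 0` some
regular all-scales STPP family in the tower `ℤ/(p^k)` beats `p^k` at exponent `(2+ε)/3` at
infinitely many scales forces `ω(ℂ) = 2`.

Proof (pure logic plus two tree theorems, self-contained — it does not invoke the route file's
deciding theorem `closes`, so it survives re-renderings of that theorem): `ω(ℂ) ≥ 2` is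
`Literature.Computability.AlgebraicComplexity.omega_two_le`; if `ω(ℂ) > 2`, put `ε := ω(ℂ) − 2`,
take a scale `k` where the packing sum at exponent `ω(ℂ)/3` exceeds `p^k`, reindex the level-`k`
family (index type `Fin k → ι`) along `Fintype.equivFin` to a `Fin N`-indexed `IsSTPP` family
(`addSimultaneousTPP_iff_forall`) and apply CKSU 2005 Thm. 5.5, abelian case
(`CohnKleinbergSzegedyUmans2005_5_5_abelian_holds`, proved in tree) in the finite abelian group
`ℤ/(p^k)` of cardinality `p^k`: contradiction.
-/

-- single-conjunct summit: the mandated namespace `Summit.MatrixMultiplication.MatrixMultiplication.…`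
-- repeats `MatrixMultiplication` (summit = sub-problem), which `linter.dupNamespace` would flag.
set_option linter.dupNamespace false

namespace Summit.MatrixMultiplication.MatrixMultiplication.Theorems

open Summit.MatrixMultiplication.MatrixMultiplication.Theses.AutomaticSTPPDesigns

/-- CKSU 2005 Thm. 5.5 (abelian case, the tree theorem
`CohnKleinbergSzegedyUmans2005_5_5_abelian_holds`) for an STPP family indexed by an arbitrary
`Fintype J` instead of `Fin N`: if `(A w, B w, C w)_{w ∈ J}` satisfies `AddSimultaneousTPP` in a
finite abelian group `H` then `∑_w (|A w| |B w| |C w|)^{ω(ℂ)/3} ≤ |H|`. Reindex along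
`Fintype.equivFin J` (injective, so the one-clause STPP form `addSimultaneousTPP_iff_forall`
transfers) and use `Equiv.sum_comp`. [cite: CohnKleinbergSzegedyUmans2005, Thm. 5.5] -/
theorem automaticSTPPDesigns_cksu_fintype (J : Type) [Fintype J] (H : Type) [AddCommGroup H]
    [Fintype H] (A B C : J → Finset H)
    (hS : Literature.Combinatorics.Additive.AddSimultaneousTPP A B C) :
    ∑ w, (((A w).card * (B w).card * (C w).card : ℕ) : ℝ) ^
        (Literature.Computability.AlgebraicComplexity.omega ℂ / 3) ≤ (Fintype.card H : ℝ) := by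
  classical
  set e : Fin (Fintype.card J) ≃ J := (Fintype.equivFin J).symm
  have hS' : Literature.Computability.AlgebraicComplexity.IsSTPP (A ∘ e) (B ∘ e) (C ∘ e) := by
    rw [Literature.Combinatorics.Additive.addSimultaneousTPP_iff_forall] at hS
    intro i j l s hs s' hs' t ht t' ht' u hu u' hu' h0
    obtain ⟨hij, hjl, rest⟩ := hS (e i) (e j) (e l) s hs s' hs' t ht t' ht' u hu u' hu' h0
    exact ⟨e.injective hij, e.injective hjl, rest⟩
  have hle :=
    Literature.Computability.AlgebraicComplexity.CohnKleinbergSzegedyUmans2005_5_5_abelian_holds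
      H (Fintype.card J) (A ∘ e) (B ∘ e) (C ∘ e) hS'
  calc ∑ w, (((A w).card * (B w).card * (C w).card : ℕ) : ℝ) ^
        (Literature.Computability.AlgebraicComplexity.omega ℂ / 3)
      = ∑ i, ((((A ∘ e) i).card * ((B ∘ e) i).card * ((C ∘ e) i).card : ℕ) : ℝ) ^
        (Literature.Computability.AlgebraicComplexity.omega ℂ / 3) :=
        (e.sum_comp (fun w => (((A w).card * (B w).card * (C w).card : ℕ) : ℝ) ^
          (Literature.Computability.AlgebraicComplexity.omega ℂ / 3))).symm
    _ ≤ (Fintype.card H : ℝ) := hle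

/-- **Assembly of route `AutomaticSTPPDesigns`** (settles `stmt-MatrixMultiplication-7363`; exact
route signature `Summit.MatrixMultiplication.MatrixMultiplication.Theses.AutomaticSTPPDesigns.Assembly`):
`AutomaticPackingThesis → MatrixMultiplication`. If `ω(ℂ) > 2`, the thesis at `ε := ω(ℂ) − 2`
gives a scale `k` and an STPP family in `ℤ/(p^k)` (indexed by `Fin k → ι`) with
`p^k < ∑_w (|A_w||B_w||C_w|)^{ω(ℂ)/3}`, contradicting CKSU 2005 Thm. 5.5
(`automaticSTPPDesigns_cksu_fintype`, `|ℤ/(p^k)| = p^k`); `ω(ℂ) ≥ 2` is `omega_two_le`.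
[cite: CohnKleinbergSzegedyUmans2005, Thm. 5.5] -/
theorem automaticSTPPDesigns_assembly_proof :
    Summit.MatrixMultiplication.MatrixMultiplication.Theses.AutomaticSTPPDesigns.Assembly := by
  unfold Summit.MatrixMultiplication.MatrixMultiplication.Theses.AutomaticSTPPDesigns.Assembly
  intro h
  rw [MatrixMultiplication_iff]
  refine le_antisymm ?_ (Literature.Computability.AlgebraicComplexity.omega_two_le ℂ)
  refine not_lt.1 fun hlt => ?_
  obtain ⟨p, hp, h⟩ := h
  obtain ⟨ι, _, LA, LB, LC, -, -, -, hS, hbeat⟩ :=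
    h (Literature.Computability.AlgebraicComplexity.omega ℂ - 2) (sub_pos.2 hlt)
  obtain ⟨k, -, hk⟩ := hbeat 0
  have hexp : (2 + (Literature.Computability.AlgebraicComplexity.omega ℂ - 2)) / 3 =
      Literature.Computability.AlgebraicComplexity.omega ℂ / 3 := by ring
  rw [hexp] at hk
  haveI : NeZero (p ^ k) := ⟨pow_ne_zero _ (by omega)⟩
  have hle := automaticSTPPDesigns_cksu_fintype (Fin k → ι) (ZMod (p ^ k)) _ _ _ (hS k)
  rw [ZMod.card, Nat.cast_pow] at hle
  exact absurd (hk.trans_le hle) (lt_irrefl _)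

end Summit.MatrixMultiplication.MatrixMultiplication.Theorems
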